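import Mathlib
import HarnessLib

/-!
# Kollár–Szabó going down, step (K3): a rational map to a proper scheme is defined at every
# valuation-ring point, and its maximal domain is stable under a compatible group action
# (crux `WildQuotients.WildQuotientResolution`, stub `stub_phaseZeroHighDim`)

Crux stmt-ResolutionOfSingularities-15640 (`WildQuotientResolution`), registered stub `stub_phaseZeroHighDim`.
Hand 6-g4's negative side-lemma ✓`not_primeOrbitSeparation_of_commuting_conjugates` (p824255) is conditional on
the named fact `Literature.AlgebraicGeometry.GroupActions.KollarSzaboGoingDown` (Reichstein–Youssin 2000, App.,
Prop. A.2). Its printed proof is an induction on `dim X` through the blow-up of the fixed point; the one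
non-local input of the induction step is that the `H`-equivariant rational map `Bl_x X ⇢ Y` (`Y` proper) is
DEFINED, `H`-equivariantly, at the generic point of the exceptional divisor — a codimension-one point of a
normal scheme. This file proves that input in Mathlib's language of partial / rational maps
(`Scheme.PartialMap`, `Scheme.RationalMap`, `RationalMap.domain`):

* `mem_domain_of_valuationRing_stalk` — for `X` integral over `S`, `Y → S` universally closed and locally
  of finite type, and an `S`-partial map `φ : X ⊇ W → Y`, every point `x ∈ X` whose local ring is a
  VALUATION RING lies in the domain of definition of the rational map `[φ]` (valuative criterion of
  universal closedness for `Spec 𝒪_{X,x}` with fraction field `K(X)`, spreading out, and agreement at the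
  generic point; the argument of Liu, *Algebraic Geometry and Arithmetic Curves*, proof of Thm. 10.2.14 /
  Milne, *Abelian Varieties*, Lemma 3.2, here for an arbitrary base and an arbitrary valuation-ring point).
* `mem_domain_of_isDiscreteValuationRing_stalk` — the codimension-one form (discrete valuation ring).

[OURS · crux stmt-ResolutionOfSingularities-15640 · helper toward `stub_phaseZeroHighDim` via the discharge of
the named fact `KollarSzaboGoingDown` (item (K3) of memo PHASE0-KS-EIGENLINE.md, hand 8-g0); NOT a proof of the
stub; counted 0; AI-level work, weaker than expert review.] [folklore]
-/

-- single-problem summit: the doubled namespace component `ResolutionOfSingularities` is forced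
set_option linter.dupNamespace false

noncomputable section

open CategoryTheory CategoryTheory.Limits AlgebraicGeometry TopologicalSpace

namespace Summit.ResolutionOfSingularities.ResolutionOfSingularities.Theorems.WildQuotientResolution.KSGoingDown

universe u

variable {X Y S : Scheme.{u}} [IsIntegral X] (sX : X ⟶ S) (sY : Y ⟶ S)

/-- **A rational map into a universally closed scheme of finite type is defined at every
valuation-ring point.** Let `X` be integral over `S`, `sY : Y → S` universally closed and locally of
finite type, `φ` a partial map `X ⊇ W → Y` over `S`, and `x ∈ X` a point whose local ring `𝒪_{X,x}`
is a valuation ring. Then `x` lies in the domain of definition of the rational map `[φ]`: the valuative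
criterion (Mathlib `UniversallyClosed.eq_valuativeCriterion`) extends `Spec K(X) → W → Y` to
`Spec 𝒪_{X,x} → Y` over `S`, this spreads out to a partial map defined at `x`
(`Scheme.PartialMap.ofFromSpecStalk`), which agrees with `φ` at the generic point and so defines the
same rational map (`Scheme.PartialMap.equiv_of_fromSpecStalkOfMem_eq`).
[cite: Liu2002, proof of Thm. 10.2.14] -/
theorem mem_domain_of_valuationRing_stalk [UniversallyClosed sY] [LocallyOfFiniteType sY]
    (φ : X.PartialMap Y) (hφ : φ.hom ≫ sY = φ.domain.ι ≫ sX)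
    {x : X} (hx : ValuationRing (X.presheaf.stalk x)) :
    x ∈ φ.toRationalMap.domain := by
  by_cases hxU : x ∈ φ.domain
  · exact φ.le_domain_toRationalMap hxU
  have hη : genericPoint X ∈ φ.domain :=
    (genericPoint_specializes _).mem_open φ.domain.2 φ.dense_domain.nonempty.choose_spec
  -- the valuative square at `x`
  have hsp : genericPoint X ⤳ x := genericPoint_specializes x
  have halg : CommRingCat.ofHom (algebraMap (X.presheaf.stalk x) X.functionField) =
      X.presheaf.stalkSpecializes hsp := rfl
  let i₁ : Spec X.functionField ⟶ Y := φ.domain.fromSpecStalkOfMem (genericPoint X) hη ≫ φ.hom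
  let i₂ : Spec (X.presheaf.stalk x) ⟶ S := X.fromSpecStalk x ≫ sX
  have sq : CommSq i₁ (Spec.map (CommRingCat.ofHom
      (algebraMap (X.presheaf.stalk x) X.functionField))) sY i₂ := ⟨by
    change (φ.domain.fromSpecStalkOfMem (genericPoint X) hη ≫ φ.hom) ≫ sY =
      Spec.map (CommRingCat.ofHom (algebraMap (X.presheaf.stalk x) X.functionField)) ≫
        X.fromSpecStalk x ≫ sX
    rw [Category.assoc, hφ, Scheme.Opens.fromSpecStalkOfMem_ι_assoc, halg,
      Scheme.SpecMap_stalkSpecializes_fromSpecStalk_assoc]⟩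
  have hE : ValuativeCriterion.Existence sY := by
    have h := (inferInstance : UniversallyClosed sY)
    rw [UniversallyClosed.eq_valuativeCriterion] at h
    exact h.1
  let Sq : ValuativeCommSq sY :=
    { R := X.presheaf.stalk x
      domain := (inferInstance : IsDomain (X.presheaf.stalk x))
      valuationRing := hx
      K := X.functionField
      isFractionRing := (inferInstance : IsFractionRing (X.presheaf.stalk x) X.functionField)
      i₁ := i₁, i₂ := i₂, commSq := sq }
  obtain ⟨ℓ⟩ := (hE Sq).exists_lift
  obtain ⟨l, hℓ₁, hℓ₂⟩ : ∃ l : Spec (X.presheaf.stalk x) ⟶ Y,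
      Spec.map (CommRingCat.ofHom (algebraMap (X.presheaf.stalk x) X.functionField)) ≫ l = i₁ ∧
      l ≫ sY = X.fromSpecStalk x ≫ sX :=
    ⟨ℓ.l, ℓ.fac_left, ℓ.fac_right⟩
  -- spread out to an open neighbourhood of `x`
  let ψ : X.PartialMap Y := Scheme.PartialMap.ofFromSpecStalk sX sY l hℓ₂
  have hxψ : x ∈ ψ.domain := Scheme.PartialMap.mem_domain_ofFromSpecStalk sX sY l hℓ₂
  have hηψ : genericPoint X ∈ ψ.domain := hsp.mem_open ψ.domain.2 hxψ
  -- the two partial maps agree at the generic point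
  have e1 : ψ.domain.fromSpecStalkOfMem (genericPoint X) hηψ =
      Spec.map (X.presheaf.stalkSpecializes hsp) ≫ ψ.domain.fromSpecStalkOfMem x hxψ := by
    rw [← cancel_mono ψ.domain.ι, Category.assoc, Scheme.Opens.fromSpecStalkOfMem_ι,
      Scheme.Opens.fromSpecStalkOfMem_ι, Scheme.SpecMap_stalkSpecializes_fromSpecStalk]
  have key : ψ.fromSpecStalkOfMem hηψ = φ.fromSpecStalkOfMem hη := by
    change ψ.domain.fromSpecStalkOfMem (genericPoint X) hηψ ≫ ψ.hom =
      φ.domain.fromSpecStalkOfMem (genericPoint X) hη ≫ φ.hom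
    rw [e1, Category.assoc]
    change Spec.map (X.presheaf.stalkSpecializes hsp) ≫ ψ.fromSpecStalkOfMem hxψ = i₁
    rw [Scheme.PartialMap.fromSpecStalkOfMem_ofFromSpecStalk, ← hℓ₁, halg]
  have heq : ψ.toRationalMap = φ.toRationalMap :=
    Scheme.PartialMap.toRationalMap_eq_iff.mpr
      (Scheme.PartialMap.equiv_of_fromSpecStalkOfMem_eq ψ φ hηψ hη key)
  exact Scheme.RationalMap.mem_domain.mpr ⟨ψ, hxψ, heq⟩

/-- **Codimension-one form**: a rational map from an integral `S`-scheme to a universally closed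
`S`-scheme of finite type is defined at every point whose local ring is a discrete valuation ring —
e.g. every normal (or regular) point of codimension one. [cite: Liu2002, proof of Thm. 10.2.14] -/
theorem mem_domain_of_isDiscreteValuationRing_stalk [UniversallyClosed sY] [LocallyOfFiniteType sY]
    (φ : X.PartialMap Y) (hφ : φ.hom ≫ sY = φ.domain.ι ≫ sX)
    {x : X} (hx : IsDiscreteValuationRing (X.presheaf.stalk x)) :
    x ∈ φ.toRationalMap.domain :=
  mem_domain_of_valuationRing_stalk sX sY φ hφ inferInstance


/-! ## Group actions: the maximal domain is stable and the maximal representative is equivariant -/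

section Equivariant

universe v

variable {G : Type v} [Group G] (σ : G →* Aut X) (τ : G →* Aut Y)

omit [IsIntegral X] in
/-- `(σ g⁻¹).hom ≫ (σ g).hom = 𝟙`. [folklore] -/
theorem aut_inv_hom_comp_aut_hom (g : G) : (σ g⁻¹).hom ≫ (σ g).hom = 𝟙 X := by
  rw [← Iso.trans_hom, ← Aut.Aut_mul_def, ← map_mul, mul_inv_cancel, map_one]
  rfl

omit [IsIntegral X] in
/-- `(σ g⁻¹) ((σ g) y) = y`. [folklore] -/
theorem aut_inv_base_aut_base (g : G) (y : X) : (σ g⁻¹).hom.base ((σ g).hom.base y) = y := by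
  rw [← Scheme.Hom.comp_apply, ← Iso.trans_hom, ← Aut.Aut_mul_def, ← map_mul, inv_mul_cancel,
    map_one]
  rfl

omit [IsIntegral X] in
/-- **The domain of definition of an equivariant rational map is stable under the group.** Let a
group `G` act on `X` (integral) and on `Y` by automorphisms `σ`, `τ`, and let `φ : X ⊇ W → Y` be a
partial map on a `G`-STABLE dense open `W` which is `G`-EQUIVARIANT (`σ_g|_W ≫ φ = φ ≫ τ_g`). Then
the domain of definition of the rational map `[φ]` is `G`-stable: with `ψ ∋ y` a representative of
`[φ]`, the conjugate `τ_g ∘ ψ ∘ σ_{g⁻¹}` is a representative defined at `σ_g y`. [folklore] -/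
theorem preimage_aut_domain_eq (φ : X.PartialMap Y)
    (hst : ∀ g, (σ g).hom ⁻¹ᵁ φ.domain = φ.domain)
    (hequiv : ∀ g, (σ g).hom.resLE φ.domain φ.domain (hst g).ge ≫ φ.hom = φ.hom ≫ (τ g).hom)
    (g : G) : (σ g).hom ⁻¹ᵁ φ.toRationalMap.domain = φ.toRationalMap.domain := by
  -- main claim: the domain is mapped into itself by every `σ g`
  have claim : ∀ (g : G) (y : X), y ∈ φ.toRationalMap.domain →
      (σ g).hom.base y ∈ φ.toRationalMap.domain := by
    intro g y hy
    obtain ⟨ψ, hyψ, hψ⟩ := Scheme.RationalMap.mem_domain.mp hy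
    -- the conjugate partial map `τ_g ∘ ψ ∘ σ_{g⁻¹}` on `σ_{g⁻¹}⁻¹(dom ψ) = σ_g (dom ψ)`
    have hopen : IsOpenMap (σ g⁻¹).hom.base := (σ g⁻¹).hom.isOpenEmbedding.isOpenMap
    let ψ' : X.PartialMap Y :=
      { domain := (σ g⁻¹).hom ⁻¹ᵁ ψ.domain
        dense_domain := ψ.dense_domain.preimage hopen
        hom := (σ g⁻¹).hom.resLE ψ.domain ((σ g⁻¹).hom ⁻¹ᵁ ψ.domain) le_rfl ≫ ψ.hom ≫ (τ g).hom }
    have hyψ' : (σ g).hom.base y ∈ ψ'.domain := by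
      change (σ g⁻¹).hom.base ((σ g).hom.base y) ∈ ψ.domain
      rw [aut_inv_base_aut_base]
      exact hyψ
    refine Scheme.RationalMap.mem_domain.mpr ⟨ψ', hyψ', ?_⟩
    -- `ψ'` represents `[φ]`: it agrees with `φ` on `V' = σ_{g⁻¹}⁻¹(V)` where `ψ = φ` on `V`
    obtain ⟨V, hV, hVψ, hVφ, e⟩ := Scheme.PartialMap.toRationalMap_eq_iff.mp hψ
    simp only [Scheme.PartialMap.restrict_hom] at e
    have hV'dense : Dense (((σ g⁻¹).hom ⁻¹ᵁ V : X.Opens) : Set X) := hV.preimage hopen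
    have hV'ψ' : (σ g⁻¹).hom ⁻¹ᵁ V ≤ ψ'.domain := fun z hz => hVψ hz
    have hV'φ : (σ g⁻¹).hom ⁻¹ᵁ V ≤ φ.domain := by
      intro z hz
      have hz' : z ∈ (σ g⁻¹).hom ⁻¹ᵁ φ.domain := hVφ hz
      rwa [hst] at hz'
    refine Scheme.PartialMap.toRationalMap_eq_iff.mpr ⟨_, hV'dense, hV'ψ', hV'φ, ?_⟩
    simp only [Scheme.PartialMap.restrict_hom]
    change X.homOfLE hV'ψ' ≫ (σ g⁻¹).hom.resLE ψ.domain ((σ g⁻¹).hom ⁻¹ᵁ ψ.domain) le_rfl ≫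
        ψ.hom ≫ (τ g).hom = X.homOfLE hV'φ ≫ φ.hom
    have h1 : X.homOfLE hV'ψ' ≫ (σ g⁻¹).hom.resLE ψ.domain ((σ g⁻¹).hom ⁻¹ᵁ ψ.domain) le_rfl =
        (σ g⁻¹).hom.resLE V ((σ g⁻¹).hom ⁻¹ᵁ V) le_rfl ≫ X.homOfLE hVψ := by
      rw [Scheme.Hom.map_resLE, Scheme.Hom.resLE_map]
    have h2 : (σ g⁻¹).hom.resLE V ((σ g⁻¹).hom ⁻¹ᵁ V) le_rfl ≫ X.homOfLE hVφ =
        X.homOfLE hV'φ ≫ (σ g⁻¹).hom.resLE φ.domain φ.domain (hst g⁻¹).ge := by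
      rw [Scheme.Hom.map_resLE, Scheme.Hom.resLE_map]
    have h3 : (τ g⁻¹).hom ≫ (τ g).hom = 𝟙 Y := aut_inv_hom_comp_aut_hom τ g
    rw [← Category.assoc, h1, Category.assoc, ← Category.assoc (X.homOfLE hVψ), e, Category.assoc,
      ← Category.assoc, h2, Category.assoc, ← Category.assoc ((σ g⁻¹).hom.resLE _ _ _),
      hequiv g⁻¹, Category.assoc, h3, Category.comp_id]
  ext y
  constructor
  · intro hy
    have h := claim g⁻¹ _ hy
    rw [aut_inv_base_aut_base] at h
    exact h
  · intro hy
    exact claim g y hy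

/-- **The maximal representative restricts to `φ` on `W`.** [folklore] -/
theorem homOfLE_comp_toPartialMap_hom [Y.IsSeparated] (φ : X.PartialMap Y) :
    X.homOfLE φ.le_domain_toRationalMap ≫ φ.toRationalMap.toPartialMap.hom = φ.hom := by
  have h := φ.toPartialMap_toRationalMap_restrict
  rwa [Scheme.PartialMap.restrict_hom] at h

/-- **The maximal representative of an equivariant rational map is equivariant.** In the situation of
`preimage_aut_domain_eq`, with `Y` separated, the canonical partial map of `[φ]` on its (stable)
domain of definition `D` (Mathlib `RationalMap.toPartialMap`) satisfies `σ_g|_D ≫ Φ = Φ ≫ τ_g`: both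
sides agree on the dense open `W ⊆ D` and `Y` is separated. [folklore] -/
theorem resLE_comp_toPartialMap_hom [Y.IsSeparated] (φ : X.PartialMap Y)
    (hst : ∀ g, (σ g).hom ⁻¹ᵁ φ.domain = φ.domain)
    (hequiv : ∀ g, (σ g).hom.resLE φ.domain φ.domain (hst g).ge ≫ φ.hom = φ.hom ≫ (τ g).hom)
    (g : G) :
    (σ g).hom.resLE φ.toRationalMap.domain φ.toRationalMap.domain
        (preimage_aut_domain_eq σ τ φ hst hequiv g).ge ≫ φ.toRationalMap.toPartialMap.hom =
      φ.toRationalMap.toPartialMap.hom ≫ (τ g).hom := by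
  have hWD : φ.domain ≤ φ.toRationalMap.domain := φ.le_domain_toRationalMap
  haveI : IsDominant (X.homOfLE hWD) := AlgebraicGeometry.Opens.isDominant_homOfLE φ.dense_domain _
  have hΦW : X.homOfLE hWD ≫ φ.toRationalMap.toPartialMap.hom = φ.hom :=
    homOfLE_comp_toPartialMap_hom φ
  refine ext_of_isDominant (ι := X.homOfLE hWD) ?_
  have h1 : X.homOfLE hWD ≫ (σ g).hom.resLE φ.toRationalMap.domain φ.toRationalMap.domain
        (preimage_aut_domain_eq σ τ φ hst hequiv g).ge =
      (σ g).hom.resLE φ.domain φ.domain (hst g).ge ≫ X.homOfLE hWD := by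
    rw [Scheme.Hom.map_resLE, Scheme.Hom.resLE_map]
  rw [← Category.assoc, h1, Category.assoc, hΦW, hequiv g, ← hΦW, Category.assoc]
  rfl

/-- **The maximal representative is an `S`-morphism** when `φ` is one and `S` is separated. [folklore] -/
theorem toPartialMap_hom_comp [Y.IsSeparated] [S.IsSeparated] (φ : X.PartialMap Y)
    (hφ : φ.hom ≫ sY = φ.domain.ι ≫ sX) :
    φ.toRationalMap.toPartialMap.hom ≫ sY = φ.toRationalMap.domain.ι ≫ sX := by
  have hWD : φ.domain ≤ φ.toRationalMap.domain := φ.le_domain_toRationalMap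
  haveI : IsDominant (X.homOfLE hWD) := AlgebraicGeometry.Opens.isDominant_homOfLE φ.dense_domain _
  -- (stated for a morphism `Ψ` out of `↥(domain [φ])` to keep the source syntactically rigid)
  have key : ∀ Ψ : (φ.toRationalMap.domain : Scheme.{u}) ⟶ Y, X.homOfLE hWD ≫ Ψ = φ.hom →
      Ψ ≫ sY = φ.toRationalMap.domain.ι ≫ sX := by
    intro Ψ hΨ
    refine ext_of_isDominant (ι := X.homOfLE hWD) ?_
    rw [← Category.assoc, hΨ, hφ, ← Category.assoc, Scheme.homOfLE_ι]
  exact key _ (homOfLE_comp_toPartialMap_hom φ)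

/-- **Equivariant extension across a valuation-ring point** (the input of the induction step of
Kollár–Szabó's «going down», [RY2000, App., proof of Prop. A.2]). Let `X` be integral over a separated
`S`, `sY : Y → S` universally closed and locally of finite type with `Y` separated, a group `G` acting
on `X` and `Y` by automorphisms, `φ : X ⊇ W → Y` a `G`-equivariant `S`-partial map on a `G`-stable dense
open `W`, and `x ∈ X` a point whose local ring is a valuation ring. Then there are a `G`-STABLE open
`D ⊇ W` CONTAINING `x` and a `G`-EQUIVARIANT `S`-morphism `Φ : D → Y` extending `φ` (namely the domain of
definition of `[φ]` and its canonical representative). [cite: ReichsteinYoussin2000, Appendix, proof of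
Prop. A.2] -/
theorem exists_stable_equivariant_extension [Y.IsSeparated] [S.IsSeparated] [UniversallyClosed sY]
    [LocallyOfFiniteType sY] (φ : X.PartialMap Y) (hφ : φ.hom ≫ sY = φ.domain.ι ≫ sX)
    (hst : ∀ g, (σ g).hom ⁻¹ᵁ φ.domain = φ.domain)
    (hequiv : ∀ g, (σ g).hom.resLE φ.domain φ.domain (hst g).ge ≫ φ.hom = φ.hom ≫ (τ g).hom)
    {x : X} (hx : ValuationRing (X.presheaf.stalk x)) :
    ∃ (D : X.Opens) (hD : ∀ g, (σ g).hom ⁻¹ᵁ D = D) (hWD : φ.domain ≤ D) (Φ : (D : Scheme.{u}) ⟶ Y),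
      x ∈ D ∧ Φ ≫ sY = D.ι ≫ sX ∧ X.homOfLE hWD ≫ Φ = φ.hom ∧
      ∀ g, (σ g).hom.resLE D D (hD g).ge ≫ Φ = Φ ≫ (τ g).hom :=
  ⟨φ.toRationalMap.domain, preimage_aut_domain_eq σ τ φ hst hequiv, φ.le_domain_toRationalMap,
    φ.toRationalMap.toPartialMap.hom, mem_domain_of_valuationRing_stalk sX sY φ hφ hx,
    toPartialMap_hom_comp sX sY φ hφ, homOfLE_comp_toPartialMap_hom φ,
    resLE_comp_toPartialMap_hom σ τ φ hst hequiv⟩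

end Equivariant

end Summit.ResolutionOfSingularities.ResolutionOfSingularities.Theorems.WildQuotientResolution.KSGoingDown

end
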